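import Literature.AlgebraicGeometry.Resolution.BlowupStalkCharts
import Literature.AlgebraicGeometry.Resolution.HypersurfaceTransform
import Literature.AlgebraicGeometry.Resolution.MarkedIdealsEtale
import HarnessLib

/-!
# Which chart of a blow-up contains a given point: `x' ∈ D₊(bt)` iff `b` generates `C · 𝒪_{X',x'}` (Stacks 0804)

Topic: `Literature/AlgebraicGeometry/Resolution`. Plumbing for the lifting step of Kollár's
uniqueness theorem for blow-up sequences (*Lectures on Resolution of Singularities* (2007),
Thm. 3.97, p. 166 of the held copy: "On the blow-up `π_i : X_{i+1} → X_i` consider the local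
chart `y_1 = x_1/x_r, …`" — the two lifted morphisms `ψ_{i+1}, ψ'_{i+1}` have to be compared on
ONE chart of the blow-up, which requires knowing that a point lies on the chart `D₊(x_r t)` as
soon as `x_r` generates the exceptional ideal at it). For a blowing up `π : X' → X` along `C`
(`IsBlowup π C`, universal property, `Blowups.lean`) and an affine open `U ⊆ X` the tree provides
charts `Spec (R[It])_{(bt)} → X'` (`R = Γ(X, U)`, `I = C(U)`, `b ∈ I`) through any given point
(`IsBlowup.exists_chartι_of_mem`, `BlowupCharts.lean`). This file PROVES:

* `IsEffectiveCartier.exists_stalkIdeal_eq_span` — the stalks of an effective Cartier divisor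
  are generated by nonzerodivisors; `isEffectiveCartier_of_ideal_top_eq_span`,
  `affineBlowup.isEffectiveCartier_idealSheaf_span_singleton` — principal ideals of
  nonzerodivisors on affine schemes are effective Cartier divisors;
* `IsBlowup.exists_charts` — **the charts `g_b : Spec (R[It])_{(bt)} → X'` for ALL `b ∈ C(U)` at
  once** (open immersions over `Spec R → X` through `R → (R[It])_{(bt)}`, jointly covering
  `π⁻¹(U)`; all cut out of one identification `π⁻¹(U) ≅ Proj R[It]`,
  `IsBlowup.exists_chartImmersion`);
* `appLE_chart_eq` — on such a chart `π^*` is `R → (R[It])_{(bt)}`;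
* `stalkIdeal_comap_eq_span_of_chart` — **easy direction**: at a point of the chart `g_b` the
  exceptional ideal `C · 𝒪_{X',x'}` is generated by (the image of) `b`, a nonzerodivisor;
* `IsBlowup.mem_range_chart_of_stalkIdeal_eq_span` — **hard direction: if `b` generates
  `C · 𝒪_{X',x'}` then `x'` lies on the chart `g_b`.** Proof by the universal properties only:
  `u = π^♯(b)` is then a nonzerodivisor generating `I · 𝒪_{X',x'}`, so the Rees algebra maps to
  `𝒪_{X',x'}` by `x tⁿ ↦ π^♯(x)/uⁿ` (`exists_ringHom_reesAlgebra`, Görtz–Wedhorn p. 415), `b t ↦ 1`,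
  whence a ring map `χ : (R[It])_{(bt)} → 𝒪_{X',x'}` over `R`; the two morphisms
  `Spec 𝒪_{X',x'} → Spec (R[It])_{(bt)} → X'` and `Spec 𝒪_{X',x'} → X'` agree after `π` and pull
  `C` back to the effective Cartier divisor `(u)`, hence coincide (`IsBlowup.hom_ext`), and the
  closed point shows `x' ∈ g_b(Spec (R[It])_{(bt)})`.

## Sources

* The Stacks Project, Tag 0804 (Lemma 31.32.2: the affine charts of a blowing up and their
  universal property), Tag 0806. [StacksProject]
* U. Görtz, T. Wedhorn, *Algebraic Geometry I*, 2nd ed. (2020), Prop. 13.92 and its proof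
  (p. 415: the `A`-algebra homomorphisms `A[I/f] → C`). [GortzWedhorn2020]
* J. Kollár, *Lectures on Resolution of Singularities* (2007), proof of Thm. 3.97 (p. 166).
  [Kollar2007]
-/

noncomputable section

open CategoryTheory CategoryTheory.Limits AlgebraicGeometry TopologicalSpace IsLocalRing
  HomogeneousLocalization

namespace Literature.AlgebraicGeometry.Resolution

universe u

/-! ## Effective Cartier divisors: stalks, and principal ideals of nonzerodivisors -/

/-- **The stalks of an effective Cartier divisor are generated by nonzerodivisors.** [folklore] -/
theorem IsEffectiveCartier.exists_stalkIdeal_eq_span {X : Scheme.{u}} {K : X.IdealSheafData}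
    (hK : IsEffectiveCartier K) (x : X) :
    ∃ t ∈ nonZeroDivisors (X.presheaf.stalk x), stalkIdeal K x = Ideal.span {t} := by
  obtain ⟨U, hxU, f, hf, hKU⟩ := hK x
  letI : Algebra Γ(X, U) (X.presheaf.stalk x) := (X.presheaf.germ U x hxU).hom.toAlgebra
  haveI : IsLocalization.AtPrime (X.presheaf.stalk x) (U.2.primeIdealOf ⟨x, hxU⟩).asIdeal :=
    U.2.isLocalization_stalk ⟨x, hxU⟩
  refine ⟨(X.presheaf.germ U x hxU).hom f, ?_, ?_⟩
  · exact map_mem_nonZeroDivisors_of_isLocalization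
      (U.2.primeIdealOf ⟨x, hxU⟩).asIdeal.primeCompl (X.presheaf.stalk x) hf
  · rw [stalkIdeal_eq_map_germ K U hxU, hKU, Ideal.map_span, Set.image_singleton]

/-- On an affine scheme, an ideal sheaf whose top ideal is generated by a nonzerodivisor is an
effective Cartier divisor. [folklore] -/
theorem isEffectiveCartier_of_ideal_top_eq_span {S : Scheme.{u}} [IsAffine S]
    (K : S.IdealSheafData) {g : Γ(S, ⊤)} (hg : g ∈ nonZeroDivisors Γ(S, ⊤))
    (hK : K.ideal ⟨⊤, isAffineOpen_top S⟩ = Ideal.span {g}) : IsEffectiveCartier K :=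
  fun _ => ⟨⟨⊤, isAffineOpen_top S⟩, trivial, g, hg, hK⟩

/-- The ideal sheaf on `Spec R` of a principal ideal generated by a nonzerodivisor is an
effective Cartier divisor. [folklore] -/
theorem affineBlowup.isEffectiveCartier_idealSheaf_span_singleton {R : Type u} [CommRing R]
    {v : R} (hv : v ∈ nonZeroDivisors R) :
    IsEffectiveCartier (affineBlowup.idealSheaf (Ideal.span {v})) := by
  let ε := Scheme.ΓSpecIso (.of R)
  refine isEffectiveCartier_of_ideal_top_eq_span _ (g := ε.inv.hom v) ?_ ?_
  · exact mem_nonZeroDivisors_of_inverse ε.inv.hom ε.hom.hom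
      (fun a => by change (ε.inv ≫ ε.hom).hom a = a; rw [ε.inv_hom_id]; rfl)
      (fun a => by change (ε.hom ≫ ε.inv).hom a = a; rw [ε.hom_inv_id]; rfl) hv
  · rw [affineBlowup.idealSheaf, ideal_ofIdealTop_top, Ideal.map_span, Set.image_singleton]

/-- A nonzerodivisor pulls back to a nonzerodivisor along an injective ring map: this is
Mathlib's `mem_nonZeroDivisors_of_injective`, kept under its old name as a deprecated alias
(dedup-00676); use the Mathlib lemma. [folklore] -/
@[deprecated mem_nonZeroDivisors_of_injective (since := "2026-08-15")]
theorem mem_nonZeroDivisors_of_injective_of_map_mem {A B : Type*} [CommRing A] [CommRing B]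
    (φ : A →+* B) (hφ : Function.Injective φ) {a : A} (ha : φ a ∈ nonZeroDivisors B) :
    a ∈ nonZeroDivisors A :=
  mem_nonZeroDivisors_of_injective hφ ha

/-! ## The charts of a blowing up over an affine open, all at once -/

section Charts

variable {X' X : Scheme.{u}} {π : X' ⟶ X} {C : X.IdealSheafData}

/-- **The charts `g_b : Spec (R[It])_{(bt)} → X'` (`R = Γ(X, U)`, `I = C(U)`) of a blowing up over
an affine open `U`, for all `b ∈ I` simultaneously**: open immersions over
`Spec (R[It])_{(bt)} → Spec R → X`, jointly covering `π⁻¹(U)` (the charts `D₊(bt)` of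
`Proj R[It] ≅ π⁻¹(U)`). [cite: StacksProject, Tag 0804] -/
theorem IsBlowup.exists_charts (hπ : IsBlowup π C) (U : X.affineOpens) :
    ∃ g : ∀ (b : Γ(X, U)) (hb : b ∈ C.ideal U),
        Spec (.of (Away (reesGrading (C.ideal U)) (reesT b hb))) ⟶ X',
      (∀ b hb, IsOpenImmersion (g b hb)) ∧
      (∀ b hb, g b hb ≫ π = Spec.map (CommRingCat.ofHom (reesChartBase b hb)) ≫ U.2.fromSpec) ∧
      ∀ x' : X', π x' ∈ (U : X.Opens) → ∃ b hb, x' ∈ Set.range (g b hb) := by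
  obtain ⟨φ, hφ, hφπ, hrange⟩ := hπ.exists_chartImmersion U
  refine ⟨fun b hb => affineBlowup.chartι b hb ≫ φ, fun b hb => inferInstance, fun b hb => ?_, ?_⟩
  · rw [Category.assoc, hφπ, ← Category.assoc, affineBlowup.chartι_π]
  · intro x' hx'
    have hx'' : x' ∈ φ.opensRange := by rw [hrange]; exact hx'
    obtain ⟨z, rfl⟩ := hx''
    have hz : z ∈ (⊤ : (affineBlowup (C.ideal U)).Opens) := trivial
    rw [← affineBlowup.iSup_basicOpen_reesT_eq_top (C.ideal U)] at hz
    obtain ⟨⟨b, hb⟩, hzb⟩ := Opens.mem_iSup.mp hz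
    rw [← affineBlowup.image_top_chartι b hb] at hzb
    obtain ⟨w, -, hw⟩ := hzb
    exact ⟨b, hb, w, by rw [Scheme.Hom.comp_apply]; exact congrArg φ hw⟩

variable (U : X.affineOpens) {A : CommRingCat.{u}} (g : Spec A ⟶ X') (f : Γ(X, U) ⟶ A)
  (hg : g ≫ π = Spec.map f ≫ U.2.fromSpec)

include hg in
/-- A chart over `Spec Γ(X, U) → X` maps into `π⁻¹(U)`. [folklore] -/
theorem top_le_preimage_of_chart : (⊤ : (Spec A).Opens) ≤ (g ≫ π) ⁻¹ᵁ (U : X.Opens) := by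
  intro w _
  change (g ≫ π) w ∈ (U : X.Opens)
  rw [hg, Scheme.Hom.comp_apply]
  exact U.2.range_fromSpec.le ⟨_, rfl⟩

include hg in
/-- **On a chart `g` with `g ≫ π = Spec f ≫ (Spec Γ(X, U) → X)`, `π^*` is `f`** (followed by
`A ≅ Γ(Spec A, 𝒪)`). [cite: StacksProject, Tag 0804] -/
theorem appLE_chart_eq (e : (⊤ : (Spec A).Opens) ≤ (g ≫ π) ⁻¹ᵁ (U : X.Opens)) :
    (g ≫ π).appLE U ⊤ e = f ≫ (Scheme.ΓSpecIso A).inv := by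
  rw [appLE_congr_hom hg]
  have e₁ : (⊤ : (Spec Γ(X, U)).Opens) ≤ U.2.fromSpec ⁻¹ᵁ (U : X.Opens) := by
    rw [U.2.fromSpec_preimage_self]
  rw [← Scheme.Hom.appLE_comp_appLE _ _ (U : X.Opens) ⊤ ⊤ e₁ le_top, fromSpec_appLE_top U e₁,
    Scheme.ΓSpecIso_inv_naturality]
  congr 1

include hg in
/-- The pull-back of `C` along such a chart is the ideal sheaf of `f(C(U)) · A`.
[cite: StacksProject, Tag 0804] -/
theorem comap_comap_chart_eq :
    (C.comap π).comap g = Scheme.IdealSheafData.ofIdealTop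
      (((C.ideal U).map f.hom).map (Scheme.ΓSpecIso A).inv.hom) := by
  rw [← Scheme.IdealSheafData.comap_comp, hg, Scheme.IdealSheafData.comap_comp, comap_fromSpec,
    affineBlowup.idealSheaf]
  exact comap_ofIdealTop_SpecMap f.hom (C.ideal U)

/-- Germs of `F.appLE`: `(F^* r)_x = F^♯_x (r_{F x})`. [folklore] -/
private theorem germ_appLE_apply_aux {Y Z : Scheme.{u}} (F : Y ⟶ Z) (V : Z.Opens) (W : Y.Opens)
    (e : W ≤ F ⁻¹ᵁ V) (y : Y) (hy : y ∈ W) (r : Γ(Z, V)) :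
    (Y.presheaf.germ W y hy).hom (F.appLE V W e r) =
      (F.stalkMap y).hom ((Z.presheaf.germ V (F y) (e hy)).hom r) := by
  change (F.appLE V W e ≫ Y.presheaf.germ W y hy).hom r =
    (Z.presheaf.germ V (F y) (e hy) ≫ F.stalkMap y).hom r
  rw [Scheme.Hom.germ_stalkMap, Scheme.Hom.appLE, Category.assoc, Y.presheaf.germ_res]

include hg in
/-- **Easy direction: at a point of a chart `g` (an open immersion with
`g ≫ π = Spec f ≫ (Spec Γ(X, U) → X)`) on which `f(C(U)) · A = (f b)` with `f b` regular — e.g.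
the chart `Spec (R[It])_{(bt)}` (`map_reesChartBase_eq`, `reesChartBase_mem_nonZeroDivisors`) —
the exceptional ideal `C · 𝒪_{X',x'}` is generated by the image of `b`, a nonzerodivisor** (the
stalk map of `g` is an isomorphism, and the stalks of `Spec A` are localizations of `A`).
[cite: StacksProject, Tag 0804] -/
theorem stalkIdeal_comap_eq_span_of_chart [IsOpenImmersion g] {b : Γ(X, U)}
    (hfb : (C.ideal U).map f.hom = Ideal.span {f.hom b}) (hreg : f.hom b ∈ nonZeroDivisors A)
    (w : Spec A) (hx : π (g w) ∈ (U : X.Opens)) :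
    stalkIdeal (C.comap π) (g w) =
        Ideal.span {(π.stalkMap (g w)).hom ((X.presheaf.germ U (π (g w)) hx).hom b)} ∧
      (π.stalkMap (g w)).hom ((X.presheaf.germ U (π (g w)) hx).hom b) ∈
        nonZeroDivisors (X'.presheaf.stalk (g w)) := by
  -- notation
  let σ : X'.presheaf.stalk (g w) →+* (Spec A).presheaf.stalk w := (g.stalkMap w).hom
  haveI : IsIso (g.stalkMap w) := inferInstance
  have hσ : Function.Bijective σ := (asIso (g.stalkMap w)).commRingCatIsoToRingEquiv.bijective
  let uu : X'.presheaf.stalk (g w) :=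
    (π.stalkMap (g w)).hom ((X.presheaf.germ U (π (g w)) hx).hom b)
  let τ : A ⟶ (Spec A).presheaf.stalk w := (Scheme.ΓSpecIso A).inv ≫ (Spec A).presheaf.germ ⊤ w trivial
  -- `σ(u)` is the germ of `f b`
  have e := top_le_preimage_of_chart U g f hg
  have hσu : σ uu = τ.hom (f.hom b) := by
    have h1 := germ_appLE_apply_aux (g ≫ π) (U : X.Opens) ⊤ e w trivial b
    rw [appLE_chart_eq U g f hg e, Scheme.Hom.stalkMap_comp] at h1
    exact h1.symm
  -- the pulled-back ideal at `w` is generated by that germ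
  have hst : stalkIdeal ((C.comap π).comap g) w = Ideal.span {τ.hom (f.hom b)} := by
    rw [comap_comap_chart_eq U g f hg, stalkIdeal_eq_map_germ _ ⟨⊤, isAffineOpen_top _⟩ trivial,
      ideal_ofIdealTop_top, hfb, Ideal.map_span, Set.image_singleton, Ideal.map_span,
      Set.image_singleton]
    rfl
  have hmap : (stalkIdeal (C.comap π) (g w)).map σ = (Ideal.span {uu}).map σ := by
    rw [← stalkIdeal_comap_eq_map g (C.comap π) w, hst, Ideal.map_span, Set.image_singleton, hσu]
  refine ⟨?_, ?_⟩
  · have h := congrArg (Ideal.comap σ) hmap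
    rwa [Ideal.comap_map_of_bijective σ hσ, Ideal.comap_map_of_bijective σ hσ] at h
  · -- `f b` is regular in `A`, hence in the localization `𝒪_{Spec A, w}`, and `σ` is injective
    letI : Algebra A ((Spec A).presheaf.stalk w) := τ.hom.toAlgebra
    haveI : IsLocalization.AtPrime ((Spec A).presheaf.stalk w) w.asIdeal :=
      StructureSheaf.IsLocalization.to_stalk (R := A) w
    have hreg' : τ.hom (f.hom b) ∈ nonZeroDivisors _ :=
      map_mem_nonZeroDivisors_of_isLocalization w.asIdeal.primeCompl ((Spec A).presheaf.stalk w)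
        hreg
    rw [← hσu] at hreg'
    exact mem_nonZeroDivisors_of_injective hσ.1 hreg'

set_option maxHeartbeats 400000 in
-- the Rees chart types are large
/-- **Hard direction: a point at which `b` generates the exceptional ideal `C · 𝒪_{X',x'}` lies
on the chart `g_b : Spec (R[It])_{(bt)} → X'`** (any morphism with
`g_b ≫ π = Spec (R → (R[It])_{(bt)}) ≫ (Spec R → X)`). With `u = π^♯(b)` (a nonzerodivisor
generating `I · 𝒪_{X',x'}`), the Rees algebra maps to `𝒪_{X',x'}` by `x tⁿ ↦ π^♯(x)/uⁿ`
(GW p. 415), under which `bt ↦ 1`; so it factors through `χ : (R[It])_{(bt)} → 𝒪_{X',x'}` over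
`R`. The morphisms `Spec 𝒪_{X',x'} → Spec (R[It])_{(bt)} → X'` and `Spec 𝒪_{X',x'} → X'` agree
after `π` and pull `C` back to the effective Cartier divisor `(u)`, hence coincide (universal
property of `π`), and their values at the closed point give `x' ∈ g_b(Spec (R[It])_{(bt)})`.
[cite: StacksProject, Tag 0804; GortzWedhorn2020, Prop. 13.92 (proof, p. 415)] -/
theorem IsBlowup.mem_range_chart_of_stalkIdeal_eq_span (hπ : IsBlowup π C) (U : X.affineOpens)
    {b : Γ(X, U)} (hb : b ∈ C.ideal U)
    (gb : Spec (.of (Away (reesGrading (C.ideal U)) (reesT b hb))) ⟶ X')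
    (hgb : gb ≫ π = Spec.map (CommRingCat.ofHom (reesChartBase b hb)) ≫ U.2.fromSpec)
    {x' : X'} (hx : π x' ∈ (U : X.Opens))
    (hgen : stalkIdeal (C.comap π) x' =
      Ideal.span {(π.stalkMap x').hom ((X.presheaf.germ U (π x') hx).hom b)}) :
    x' ∈ Set.range gb := by
  -- notation: `O = 𝒪_{X',x'}`, `φ = π^♯ ∘ germ : R → O`, `u = φ b`
  let O := X'.presheaf.stalk x'
  let φ : Γ(X, U) →+* O := (π.stalkMap x').hom.comp (X.presheaf.germ U (π x') hx).hom
  -- `u` is a nonzerodivisor: the exceptional ideal is effective Cartier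
  have hu : φ b ∈ nonZeroDivisors O := by
    obtain ⟨t, ht, hKt⟩ := hπ.isEffectiveCartier.exists_stalkIdeal_eq_span x'
    rw [hgen] at hKt
    exact mem_nonZeroDivisors_of_span_singleton_eq hKt ht
  -- `I · O = (u)`
  have hIu : (C.ideal U).map φ = Ideal.span {φ b} := by
    rw [← Ideal.map_map, ← stalkIdeal_eq_map_germ C U hx, ← stalkIdeal_comap_eq_map π C x']
    exact hgen
  -- the ring map `R[It] → O`, `bt ↦ 1`, and `χ : (R[It])_{(bt)} → O`
  obtain ⟨ψ, hψR, hψT, -⟩ := exists_ringHom_reesAlgebra hu hIu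
  have hone : ψ (reesT b hb) = 1 := by
    have h1 : (ψ (reesT b hb) - 1) * φ b = 0 := by rw [sub_mul, one_mul, hψT b hb, sub_self]
    exact sub_eq_zero.mp ((mem_nonZeroDivisors_iff_right.mp hu) _ h1)
  have hunit : IsUnit (ψ (reesT b hb)) := by rw [hone]; exact isUnit_one
  let χ : Away (reesGrading (C.ideal U)) (reesT b hb) →+* O :=
    (IsLocalization.Away.lift (reesT b hb) (g := ψ) hunit :
        Localization.Away (reesT b hb) →+* O).comp
      (algebraMap (Away (reesGrading (C.ideal U)) (reesT b hb)) (Localization.Away (reesT b hb)))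
  have hχ : ∀ r, χ (reesChartBase b hb r) = φ r := by
    intro r
    change IsLocalization.Away.lift (reesT b hb) hunit
      (HomogeneousLocalization.val (HomogeneousLocalization.mk _)) = _
    rw [HomogeneousLocalization.val_mk]
    change IsLocalization.Away.lift (reesT b hb) hunit
      (Localization.mk (algebraMap Γ(X, U) (reesAlgebra (C.ideal U)) r) 1) = _
    rw [Localization.mk_one_eq_algebraMap, IsLocalization.Away.lift_eq]
    exact hψR r
  have hχcomp : CommRingCat.ofHom (reesChartBase b hb) ≫ CommRingCat.ofHom χ =
      X.presheaf.germ U (π x') hx ≫ π.stalkMap x' := by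
    ext r
    exact hχ r
  -- the two morphisms `Spec O → X'`
  let q : Spec O ⟶ X' := Spec.map (CommRingCat.ofHom χ) ≫ gb
  have hq : q ≫ π = X'.fromSpecStalk x' ≫ π := by
    change (Spec.map (CommRingCat.ofHom χ) ≫ gb) ≫ π = _
    rw [Category.assoc, hgb, ← Category.assoc, ← Spec.map_comp, hχcomp, Spec.map_comp,
      Category.assoc]
    change Spec.map (π.stalkMap x') ≫ U.2.fromSpecStalk hx = _
    rw [IsAffineOpen.fromSpecStalk_eq_fromSpecStalk, Scheme.SpecMap_stalkMap_fromSpecStalk]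
  -- `C` pulls back to the effective Cartier divisor `(u)` on `Spec O`
  have hW : IsEffectiveCartier (C.comap (q ≫ π)) := by
    rw [hq, Scheme.IdealSheafData.comap_comp, comap_fromSpecStalk_eq_affineBlowupIdealSheaf, hgen]
    exact affineBlowup.isEffectiveCartier_idealSheaf_span_singleton hu
  have hqq : q = X'.fromSpecStalk x' := hπ.hom_ext hW hq
  refine ⟨Spec.map (CommRingCat.ofHom χ) (closedPoint O), ?_⟩
  rw [← Scheme.Hom.comp_apply]
  change q (closedPoint O) = x'
  rw [hqq]
  exact Scheme.fromSpecStalk_closedPoint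

end Charts

end Literature.AlgebraicGeometry.Resolution

end
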